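import Literature.IUT.HodgeTheaters.BaseBridgeModels
import HarnessLib

/-!
# Model base-bridges ([IUTchI] Examples 4.3–4.5): proof-only companion — abc-iut cell, layer L5

Mochizuki, *Inter-universal Teichmüller theory I*, §4 (kurims May-2020 manuscript), Example 4.3 (i)/(iv)
pp. 98–100 and Example 4.5 (i) pp. 107–108. PROOF-ONLY companion of `BaseBridgeModels.lean` (abc-iut-L5-t3,
p405606; every declaration there untouched): this file adds NO definition and NO hypothesis; it kernel-checks,
over the hypothesis structure `BaseThetaDatum` of §4, the printed clauses of these Examples that the statement
file records as data or proves only in part (cone rows IUTchI:Ex4.3(i)–(iv), IUTchI:Ex4.4(iv), IUTchI:Ex4.5(i),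
D-0067 discharge wave, seat abc-iut-w4-d077):

* Ex. 4.3 (i) p. 99, "the “poly-action” [i.e., action via poly-automorphisms] of `j ∈ F_l^⋇` on `𝒟^⊚`": the
  cosets `polyAct Y j` compose like the group `F_l^⋇ ≅ Aut(†𝒟^⊚)/Aut_ε(†𝒟^⊚)` — `polyAct Y 1 = Aut_ε`
  (`polyAct_one`), composites of constituents of `polyAct Y j` and `polyAct Y g` are exactly the constituents
  of `polyAct Y (j·g)` (`polyAct_comp`), inverses (`symm_mem_polyAct_iff`). PROVED.
* Ex. 4.3 (i) p. 99, "`𝕍^{±un} := Aut_ε(C_K)·𝕍 ⊆ 𝕍^Bor := Aut(C_K)·𝕍 ⊆ 𝕍(K)` … so we may think of `𝕍^Bor` as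
  the `F_l^⋇`-orbit of `𝕍^{±un}`" (the statement file proves only `𝕍 ⊆ 𝕍^{±un} ⊆ 𝕍^Bor`): `𝕍^{±un}` is
  STABLE under `Aut_ε` (`image_valIso_vPlusMinusUn_of_autLabel_eq_one`), its translate by an automorphism
  depends only on the label `∈ F_l^⋇` of that automorphism (`image_valIso_vPlusMinusUn_eq_of_autLabel_eq`),
  and `𝕍^Bor` is the union of these `F_l^⋇`-translates (`vBor_eq_iUnion_image_vPlusMinusUn`,
  `vBor_eq_iUnion_polyAct`). PROVED.
* Ex. 4.3 (iv) p. 100, "we obtain a natural poly-action of `F_l^⋇` on the collection of data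
  (`𝒟_⋇, 𝒟^⊚, φ^NF_⋇`)": relabelling the capsule `𝒟_⋇` by `j ↦ g·j` and letting `g` poly-act on `𝒟^⊚`
  carries the model `𝒟`-NF-bridge to itself (`modelNFBridge_post_polyAct`, from t3's `phiNFj_post_polyAct`).
* Ex. 4.5 (i) p. 108, the `Θ`-half: "the data of the arrow `φ^Θ_j : 𝒟_j → 𝒟_>` at the various `v ∈ 𝕍`
  determines an isomorphism of `F_l^⋇`-torsors `LabCusp(𝒟_j) ⥲ LabCusp(𝒟_>)` … this is immediate from the
  definitions when `v ∈ 𝕍^good`": at a good place every constituent of `φ^Θ_{v_j}` is an isomorphism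
  (Ex. 4.4 (iii)), and EVERY isomorphism `†𝒟_v ⥲ ‡𝒟_v` induces on label classes THE bijection of
  Proposition 4.2 (`labIso_eq_pointedEquiv`, `exists_labIso_eq_pointedEquiv_of_mem_phiThetaAt`) — so the
  induced map is independent of the constituent; on the model (tautological) strip it is the identity and
  composing with the `NF`-half gives `φ^LC_j` (`labIso_labPull_of_mem_phiNFj`). PROVED. At `v ∈ 𝕍^bad` the
  constituents are the evaluation-section morphisms of Ex. 4.4 (i)–(ii), whose effect on cusps ("compatible
  with the outer actions on the respective geometric tempered fundamental groups", p. 107) is NOT carried by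
  the interface `BaseThetaDatum` (no fundamental groups) — recorded, not asserted (after-merge, layers L3/L4).

Nothing here takes a side on [IUTchIII] Cor. 3.12; typed ≠ discharged. [claim: Mochizuki2012, status: disputed]
-/

namespace Literature.IUT.HodgeTheaters

open CategoryTheory

universe u

namespace BaseThetaDatum

variable {𝔡 : BaseThetaDatum.{u}}

/-! ### Example 4.3 (i): the poly-action of `F_l^⋇` on `†𝒟^⊚` is an action -/

/-- Ex. 4.3 (i) p. 99: the poly-action by `1 ∈ F_l^⋇` is (the underlying set of) `Aut_ε(†𝒟^⊚)`.
[claim: Mochizuki2012, status: disputed] -/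
theorem polyAct_one (Y : 𝔡.AmbG) : 𝔡.polyAct Y 1 = (𝔡.AutEps Y : Set (Aut Y)) :=
  Set.ext fun b => mem_polyAct_one_iff b

/-- Ex. 4.3 (i): composites of constituents — a constituent of the poly-action by `j` followed by a
constituent of the poly-action by `g` is a constituent of the poly-action by `j·g`.
[claim: Mochizuki2012, status: disputed] -/
theorem trans_mem_polyAct {Y : 𝔡.AmbG} {j g : FlStar 𝔡.l} {b c : Y ≅ Y} (hb : b ∈ 𝔡.polyAct Y j)
    (hc : c ∈ 𝔡.polyAct Y g) : b ≪≫ c ∈ 𝔡.polyAct Y (j * g) := by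
  change autLabel (b ≪≫ c) = j * g
  rw [autLabel_trans, show autLabel b = j from hb, show autLabel c = g from hc]

/-- Ex. 4.3 (i): inverses — `b⁻¹` is a constituent of the poly-action by `j⁻¹` iff `b` is one of the
poly-action by `j`. [claim: Mochizuki2012, status: disputed] -/
theorem symm_mem_polyAct_iff {Y : 𝔡.AmbG} {j : FlStar 𝔡.l} (b : Y ≅ Y) :
    b.symm ∈ 𝔡.polyAct Y j⁻¹ ↔ b ∈ 𝔡.polyAct Y j := by
  change autLabel b.symm = j⁻¹ ↔ autLabel b = j
  rw [autLabel_symm, inv_inj]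

/-- **Example 4.3 (i)** ([IUTchI] p. 99), "the “poly-action” [i.e., action via poly-automorphisms] of
`j ∈ F_l^⋇` on `𝒟^⊚`" IS an action of the group `F_l^⋇ ≅ Aut(†𝒟^⊚)/Aut_ε(†𝒟^⊚)`: the composite (§0: "the
set `{g ∘ f}`") of the poly-action by `j` with the poly-action by `g` is the poly-action by `j·g`.
[claim: Mochizuki2012, status: disputed] -/
theorem polyAct_comp (Y : 𝔡.AmbG) (j g : FlStar 𝔡.l) :
    {d : Y ≅ Y | ∃ b ∈ 𝔡.polyAct Y j, ∃ c ∈ 𝔡.polyAct Y g, d = b ≪≫ c} = 𝔡.polyAct Y (j * g) := by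
  ext d
  constructor
  · rintro ⟨b, hb, c, hc, rfl⟩
    exact trans_mem_polyAct hb hc
  · intro hd
    obtain ⟨b, hb⟩ := polyAct_nonempty Y j
    refine ⟨b, hb, b.symm ≪≫ d, ?_, by rw [Iso.self_symm_id_assoc]⟩
    have h := trans_mem_polyAct ((symm_mem_polyAct_iff b).2 hb) hd
    rwa [inv_mul_cancel_left] at h

/-! ### Example 4.3 (i): `𝕍^Bor` is the `F_l^⋇`-orbit of `𝕍^{±un}` -/

/-- Transport of valuations along a composite of automorphisms of `𝒟^⊚` (interface functoriality).
[claim: Mochizuki2012, status: disputed] -/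
theorem valIso_valIso {X Y Z : 𝔡.AmbG} (b : X ≅ Y) (c : Y ≅ Z) (x : 𝔡.Val X) :
    𝔡.valIso c (𝔡.valIso b x) = 𝔡.valIso (b ≪≫ c) x := by
  rw [𝔡.valIso_trans]; rfl

/-- Transport along `b` then `b⁻¹` is the identity. [claim: Mochizuki2012, status: disputed] -/
theorem valIso_symm_valIso {X Y : 𝔡.AmbG} (b : X ≅ Y) (x : 𝔡.Val X) :
    𝔡.valIso b.symm (𝔡.valIso b x) = x := by
  rw [valIso_valIso, Iso.self_symm_id, 𝔡.valIso_refl]; rfl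

/-- Transport along `b⁻¹` then `b` is the identity. [claim: Mochizuki2012, status: disputed] -/
theorem valIso_valIso_symm {X Y : 𝔡.AmbG} (b : X ≅ Y) (y : 𝔡.Val Y) :
    𝔡.valIso b (𝔡.valIso b.symm y) = y := by
  rw [valIso_valIso, Iso.symm_self_id, 𝔡.valIso_refl]; rfl

/-- Ex. 4.3 (i): `𝕍^{±un} = Aut_ε(C_K)·𝕍` is carried into itself by every element of `Aut_ε(C_K)` (an
automorphism of label `1`). [claim: Mochizuki2012, status: disputed] -/
theorem valIso_mem_vPlusMinusUn {b : 𝔡.DG ≅ 𝔡.DG} (hb : autLabel b = 1) {x : 𝔡.Val 𝔡.DG}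
    (hx : x ∈ 𝔡.VPlusMinusUn) : 𝔡.valIso b x ∈ 𝔡.VPlusMinusUn := by
  obtain ⟨b₀, v, hb₀, rfl⟩ := hx
  refine ⟨b₀ ≪≫ b, v, ?_, by rw [valIso_valIso]⟩
  rw [autLabel_trans, hb₀, hb, one_mul]

/-- **Example 4.3 (i)** ([IUTchI] p. 99): `𝕍^{±un}` is STABLE under `Aut_ε(C_K)` — its translate by an
automorphism of label `1` is `𝕍^{±un}` itself. [claim: Mochizuki2012, status: disputed] -/
theorem image_valIso_vPlusMinusUn_of_autLabel_eq_one {b : 𝔡.DG ≅ 𝔡.DG} (hb : autLabel b = 1) :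
    𝔡.valIso b '' 𝔡.VPlusMinusUn = 𝔡.VPlusMinusUn := by
  refine Set.Subset.antisymm ?_ fun x hx => ?_
  · rintro _ ⟨x, hx, rfl⟩
    exact valIso_mem_vPlusMinusUn hb hx
  · refine ⟨𝔡.valIso b.symm x, valIso_mem_vPlusMinusUn ?_ hx, valIso_valIso_symm b x⟩
    rw [autLabel_symm, hb, inv_one]

/-- **Example 4.3 (i)** ([IUTchI] p. 99): the translate of `𝕍^{±un}` by an automorphism of `𝒟^⊚` depends only
on its image in `Aut(C_K)/Aut_ε(C_K) ⥲ F_l^⋇`, i.e. on its label — so `F_l^⋇` acts on the translates of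
`𝕍^{±un}` ("the `F_l^⋇`-orbit of `𝕍^{±un}`"). [claim: Mochizuki2012, status: disputed] -/
theorem image_valIso_vPlusMinusUn_eq_of_autLabel_eq {b b' : 𝔡.DG ≅ 𝔡.DG} (h : autLabel b = autLabel b') :
    𝔡.valIso b '' 𝔡.VPlusMinusUn = 𝔡.valIso b' '' 𝔡.VPlusMinusUn := by
  have key : ∀ {b b' : 𝔡.DG ≅ 𝔡.DG}, autLabel b = autLabel b' →
      𝔡.valIso b' '' 𝔡.VPlusMinusUn ⊆ 𝔡.valIso b '' 𝔡.VPlusMinusUn := by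
    intro b b' h
    rintro _ ⟨x, hx, rfl⟩
    have he : autLabel (b' ≪≫ b.symm) = 1 := by rw [autLabel_trans, autLabel_symm, ← h, mul_inv_cancel]
    refine ⟨𝔡.valIso (b' ≪≫ b.symm) x, valIso_mem_vPlusMinusUn he hx, ?_⟩
    rw [valIso_valIso, Iso.trans_assoc, Iso.symm_self_id, Iso.trans_refl]
  exact Set.Subset.antisymm (key h.symm) (key h)

/-- **Example 4.3 (i)** ([IUTchI] p. 99): "so we may think of `𝕍^Bor` as the `F_l^⋇`-orbit of `𝕍^{±un}`" —
`𝕍^Bor = Aut(C_K)·𝕍` is the union of the translates of `𝕍^{±un} = Aut_ε(C_K)·𝕍` by the automorphisms of `𝒟^⊚`.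
[claim: Mochizuki2012, status: disputed] -/
theorem vBor_eq_iUnion_image_vPlusMinusUn :
    𝔡.VBor = ⋃ b : 𝔡.DG ≅ 𝔡.DG, 𝔡.valIso b '' 𝔡.VPlusMinusUn := by
  ext x
  simp only [Set.mem_iUnion]
  constructor
  · rintro ⟨b, v, rfl⟩
    exact ⟨b, 𝔡.valOfV v, range_valOfV_subset_vPlusMinusUn_subset_vBor.1 ⟨v, rfl⟩, rfl⟩
  · rintro ⟨b, _, ⟨b₀, v, -, rfl⟩, rfl⟩
    exact ⟨b₀ ≪≫ b, v, by rw [valIso_valIso]⟩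

/-- **Example 4.3 (i)** ([IUTchI] p. 99), the same union indexed by `F_l^⋇`: `𝕍^Bor` is the union over
`j ∈ F_l^⋇` of the translate of `𝕍^{±un}` by the poly-action of `j` (by
`image_valIso_vPlusMinusUn_eq_of_autLabel_eq` all constituents of `polyAct 𝒟^⊚ j` give the same translate).
[claim: Mochizuki2012, status: disputed] -/
theorem vBor_eq_iUnion_polyAct :
    𝔡.VBor = ⋃ j : FlStar 𝔡.l, ⋃ b ∈ 𝔡.polyAct 𝔡.DG j, 𝔡.valIso b '' 𝔡.VPlusMinusUn := by
  rw [vBor_eq_iUnion_image_vPlusMinusUn]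
  ext x
  simp only [Set.mem_iUnion]
  constructor
  · rintro ⟨b, hx⟩
    exact ⟨autLabel b, b, rfl, hx⟩
  · rintro ⟨-, b, -, hx⟩
    exact ⟨b, hx⟩

/-! ### Example 4.3 (iv): the poly-action of `F_l^⋇` on `(𝒟_⋇, 𝒟^⊚, φ^NF_⋇)` -/

/-- **Example 4.3 (iv)** ([IUTchI] p. 100): "we obtain a natural poly-action of `F_l^⋇` on the collection of
data (`𝒟_⋇, 𝒟^⊚, φ^NF_⋇`)" — for `g ∈ F_l^⋇`, post-composing the constituent `φ^NF_j` of the model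
`𝒟`-NF-bridge with the poly-action of `g` on `𝒟^⊚` yields the constituent `φ^NF_{g·j}`, i.e. the pair
(capsule relabelling `j ↦ g·j`, poly-action of `g`) carries `φ^NF_⋇` to itself.
[claim: Mochizuki2012, status: disputed] -/
theorem modelNFBridge_post_polyAct (g j : FlStar 𝔡.l) (v : 𝔡.V) :
    (𝔡.modelNFBridge j v).post (𝔡.polyAct 𝔡.DG g) = 𝔡.modelNFBridge (g * j) v :=
  phiNFj_post_polyAct g j v

/-! ### Example 4.5 (i): the `Θ`-half of `φ^LC_j` at good places -/

/-- Prop. 4.2 / Ex. 4.5 (i): EVERY isomorphism `†𝒟_v ⥲ ‡𝒟_v` induces on label classes of cusps THE bijection of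
Proposition 4.2 — the unique one compatible with `†η_v ↦ ‡η_v` and with the `F_l^⋇`-torsor structures; in
particular the induced bijection does not depend on the isomorphism. [claim: Mochizuki2012, status: disputed] -/
theorem labIso_eq_pointedEquiv {v : 𝔡.V} {X Y : 𝔡.Amb v} (f : X ≅ Y) :
    𝔡.labIso f = (𝔡.isTorsor_labCusp v X).pointedEquiv (𝔡.isTorsor_labCusp v Y) (𝔡.η v X) (𝔡.η v Y) :=
  ((𝔡.isTorsor_labCusp v X).existsUnique_pointed_equiv (𝔡.isTorsor_labCusp v Y) (𝔡.η v X)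
      (𝔡.η v Y)).unique ⟨𝔡.labIso_η f, 𝔡.labIso_smul f⟩
    ⟨(𝔡.isTorsor_labCusp v X).pointedEquiv_self _ _ _, (𝔡.isTorsor_labCusp v X).pointedEquiv_smul _ _ _⟩

/-- Ex. 4.5 (i): two isomorphisms `†𝒟_v ⥲ ‡𝒟_v` induce the same bijection of label classes.
[claim: Mochizuki2012, status: disputed] -/
theorem labIso_eq_labIso {v : 𝔡.V} {X Y : 𝔡.Amb v} (f f' : X ≅ Y) : 𝔡.labIso f = 𝔡.labIso f' := by
  rw [labIso_eq_pointedEquiv, labIso_eq_pointedEquiv]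

/-- **Example 4.5 (i)** ([IUTchI] p. 108): "the data of the arrow `φ^Θ_j : 𝒟_j → 𝒟_>` at the various `v ∈ 𝕍`
determines an isomorphism of `F_l^⋇`-torsors `LabCusp(𝒟_j) ⥲ LabCusp(𝒟_>)` … this is immediate from the
definitions when `v ∈ 𝕍^good`": at a good place every constituent of `φ^Θ_{v_j}` is an isomorphism
(Ex. 4.4 (iii), "the full poly-isomorphism") and induces the bijection of Proposition 4.2, whatever the
constituent. [claim: Mochizuki2012, status: disputed] -/
theorem exists_labIso_eq_pointedEquiv_of_mem_phiThetaAt (j : FlStar 𝔡.l) {v : 𝔡.V} (hv : ¬ 𝔡.IsBad v)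
    {X Y : 𝔡.Amb v} {f : X ⟶ Y} (hf : f ∈ 𝔡.phiThetaAt j v X Y) :
    ∃ h : IsIso f, 𝔡.labIso (@asIso _ _ _ _ f h) =
      (𝔡.isTorsor_labCusp v X).pointedEquiv (𝔡.isTorsor_labCusp v Y) (𝔡.η v X) (𝔡.η v Y) :=
  ⟨hf.2 hv, labIso_eq_pointedEquiv _⟩

/-- **Example 4.5 (i)–(ii)** on the model: the `NF`-half of `φ^LC_j` (restriction along any constituent of
`φ^NF_j`, t3's `labPull_of_mem_phiNFj`) followed by the `Θ`-half along any automorphism of the tautological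
constituent `𝒟_{v_j} = 𝒟_{>,v}` (which acts trivially on label classes) is the `v`-component of `φ^LC_j`.
[claim: Mochizuki2012, status: disputed] -/
theorem labIso_labPull_of_mem_phiNFj {j : FlStar 𝔡.l} {v : 𝔡.V} {f : 𝔡.HomNF v (𝔡.D v) 𝔡.DG}
    (hf : f ∈ 𝔡.phiNFj j v) (a : 𝔡.D v ≅ 𝔡.D v) (c : 𝔡.LabCuspG 𝔡.DG) :
    𝔡.labIso a (𝔡.labPull f c) = (𝔡.phiLC j c).1 v := by
  rw [labIso_aut_eq_self, labPull_of_mem_phiNFj hf]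

end BaseThetaDatum

end Literature.IUT.HodgeTheaters
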